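import Summits.BirchSwinnertonDyer.BirchSwinnertonDyer.Theses.ThetaPartnerAtTwo
import Summits.BirchSwinnertonDyer.BirchSwinnertonDyer.Theorems.ThetaPartnerAtTwoSignedTransportAtTwoBridgeMazurTate
import Summits.BirchSwinnertonDyer.BirchSwinnertonDyer.Theorems.ThetaPartnerAtTwoSignedTransportAtTwoBridgeNonPrimitive
import Summits.BirchSwinnertonDyer.BirchSwinnertonDyer.Theorems.ThetaPartnerAtTwoSignedTransportAtTwoBridgeCongruence
import Summits.BirchSwinnertonDyer.BirchSwinnertonDyer.Theorems.ThetaPartnerAtTwoSignedTransportAtTwoOrientedEulerFactor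
import HarnessLib

/-!
# Crux `SignedTransportAtTwo` (stmt-BirchSwinnertonDyer-20333, route `ThetaPartnerAtTwo`): the ORIENTED analytic bridge —
# R-A `MazurTateCongruenceAtTwoR` (Mazur–Tate congruence with the ι-oriented depletion `eulerFactorProductInv`) ⇒ `V2congR`
# ⇒ the UNCHANGED `V2np`, and the compositions of line `bridge` v8 (crux BY NAME from sel2 / fin2 / Kμ2′ + Kλ2 + R-A)
# (lead prover bsd-wall-tp2-p1 g3, re-landing planner bsd-wall-p2 g7's `OrientedBridge_sketch.lean` eb79e47b6c69e449 with its
# support stubs S1–S3 PROVED in `…OrientedEulerFactor.lean`; `--supports stmt-BirchSwinnertonDyer-20333`; closes nothing)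

HONEST FRAMING. THEOREMS ONLY; every research input is an explicit hypothesis spelled inline; nothing about any curve is
asserted; BSD is not proved by any of this.

WHY. The registered analytic stub `stub_V2mt` of line `bridge` v5–v7 (= staged child `MazurTateCongruenceAtTwo`) paired the
Mazur–Tate elements `θ_n` (tree/MTT variable) with the GV-oriented depletion `eulerFactorProduct` and a CONSTANT unit; it is
numerically REFUTED AS TYPED (planner bsd-wall-p2 g7, V2MT-ORIENTATION-AT2-v1.3: three in-seat instances at `n = 4`; census
g10 V2MT-FALSIFIER-RUN1, kit j279803: 18/20 habitat pairs fail at `n = 6, 8`, the discrepancy being the unit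
`(1+T)^{log⟨N_A⟩ − log⟨N_W⟩}`) while the ORIENTED text — `eulerFactorProduct ↦ eulerFactorProductInv` on both sides (R-A,
director W-13 (b)) — holds on 20/20 pairs with `u = 1`. This file is the oriented glue: the Λ-algebra of the landed bridge
(`omega_mul_mem_of_layerCongr`, `C_pow_dvd_of_forall_even`, `ne_zero_mu_lam_of_congr`) is generic in the depletion factor,
and the only new inputs are `μ`, `λ`, `≠ 0` of `∏𝒫^ι` at `2` (`…OrientedEulerFactor.lean`, S1–S3), which agree with those
of `∏𝒫`, so the oriented congruence lands on the UNCHANGED orientation-free binder `V2np` (p520200).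

* `v2np_of_v2congR` — `V2congR ⇒ V2np`;
* `v2congR_of_v2mtR` — R-A layerwise ⇒ `V2congR` (the limit argument, verbatim port of `v2cong_of_v2mt`);
* `signedTransportAtTwo_of_gvBinders_mazurTateR` — Kμ2′ + Kλ2 + R-A ⇒ crux BY NAME;
* (`…BridgeOrientedResidual.lean`: the residual / Selmer-level compositions `…_residualR`, `…_selmerR`).

References: [GreenbergVatsal2000] §1 pp. 8–9, Thm. (1.4), Thm. (1.6), Prop. (2.4); [Vatsal1999] Thm. (1.10);
[EmertonPollackWeston2006] Thm. 1; [BDKim2009] Cor. 2.13; [Kobayashi2003] Def. 1.1, Conjecture (p. 2);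
[MazurTateTeitelbaum1986] §I.13.
-/

set_option autoImplicit false
-- D-0017: single-problem summit, so `Summit.BirchSwinnertonDyer.BirchSwinnertonDyer.…` repeats a namespace BY DESIGN.
set_option linter.dupNamespace false

noncomputable section

open scoped Classical MatrixGroups ModularForm BigOperators

open CongruenceSubgroup Polynomial WeierstrassCurve NumberField IsDedekindDomain Rat.HeightOneSpectrum
  Literature Literature.NumberTheory.EllipticCurves Literature.NumberTheory.EllipticCurves.IwasawaAlgebra
  Literature.NumberTheory.EllipticCurves.ModularForms
  Literature.NumberTheory.EllipticCurves.Rank1Residual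
  Literature.NumberTheory.EllipticCurves.Kobayashi2003 ZpExtension
  Literature.NumberTheory.EllipticCurves.GreenbergVatsal2000
  Literature.NumberTheory.EllipticCurves.Sprung2017
  Summit.BirchSwinnertonDyer.Rank1Residual.X1.MuLambda
  Summit.BirchSwinnertonDyer.Rank1Residual.Supersingular
  Summit.BirchSwinnertonDyer.Rank1Residual.X2.EulerFactorInvariants
  Summit.BirchSwinnertonDyer.BirchSwinnertonDyer.Theorems.TwoAdicTwistConverse

namespace Summit.BirchSwinnertonDyer.BirchSwinnertonDyer.Theorems.SignedTransportAtTwo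

/-- **`V2congR ⇒ V2np` (oriented)**: `V2congR → V2np` — the Λ-level congruence between the
ι-DEPLETED functions `G·∏𝒫^ι(W)`, `G_A·∏𝒫^ι(A)` (the objects `MazurTateCongruenceAtTwoR` produces via `C_pow_dvd_of_forall_even`)
lands on the UNCHANGED `V2np` (GV products) through S3. Same ten lines as `v2np_of_v2cong` + two rewrites.
[cite: GreenbergVatsal2000, §1 pp. 8–9, Thm. (1.4), Thm. (1.6)] [cite: Vatsal1999, Thm. (1.10)] -/
theorem v2np_of_v2congR
    (hV2congR :
    ∀ (W : WeierstrassCurve ℚ) [W.IsElliptic] [W.IsGloballyMinimal] (A : WeierstrassCurve ℚ) [A.IsElliptic]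
      [A.IsGloballyMinimal], ¬ W.HasCM → W.analyticRank = 0 → GoodSS W 2 → W.frobeniusTrace 2 = 0 →
      A.HasCM → GoodSS A 2 → A.frobeniusTrace 2 = 0 →
    (∃ e : WeierstrassCurve.geomTorsion W (2 : ℤ) ≃+ WeierstrassCurve.geomTorsion A (2 : ℤ),
      ∀ (σ : Field.absoluteGaloisGroup ℚ) (P : WeierstrassCurve.geomTorsion W (2 : ℤ)), e (σ • P) = σ • e P) →
    ∀ (γ : Field.absoluteGaloisGroup ℚ), IsCyclotomicVariable 2 γ →
    ∀ [NeZero (W.conductorNorm ℤ)] (f : CuspForm (Gamma0 (W.conductorNorm ℤ)) 2), IsNewformOf W f →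
    ∀ (ϖ : ℚ), (ϖ : ℝ) * W.realPeriodRat = plusPeriod f →
    ∀ (Lplus Lminus : IwasawaAlgebra 2), IsPollackPair f 2 Lplus Lminus →
    ∀ [NeZero (A.conductorNorm ℤ)] (fA : CuspForm (Gamma0 (A.conductorNorm ℤ)) 2), IsNewformOf A fA →
    ∀ (ϖA : ℚ), (ϖA : ℝ) * A.realPeriodRat = plusPeriod fA →
    ∀ (LplusA LminusA : IwasawaAlgebra 2), IsPollackPair fA 2 LplusA LminusA →
    ∀ (S₀ : Finset (HeightOneSpectrum (𝓞 ℚ))), (∀ v ∈ S₀, ((2 : ℕ) : 𝓞 ℚ) ∉ v.asIdeal) →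
      (∀ v : HeightOneSpectrum (𝓞 ℚ), ¬ W.HasGoodReductionAt v → v ∈ S₀) →
      (∀ v : HeightOneSpectrum (𝓞 ℚ), ¬ A.HasGoodReductionAt v → v ∈ S₀) →
    ∀ (G : IwasawaAlgebra 2) (m : ℕ), iwasawaToPowerSeries 2 G =
        PowerSeries.C ((2 : ℚ_[2]) ^ m * (ϖ : ℚ_[2])) * iwasawaToPowerSeries 2 (kobayashiL 1 Lplus Lminus) →
    ∀ (GA : IwasawaAlgebra 2) (m' : ℕ), iwasawaToPowerSeries 2 GA =
        PowerSeries.C ((2 : ℚ_[2]) ^ m' * (ϖA : ℚ_[2])) * iwasawaToPowerSeries 2 (kobayashiL 1 LplusA LminusA) →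
    ∃ u : ℤ_[2]ˣ, PowerSeries.C ((2 : ℤ_[2]) ^ (m + m' + 1)) ∣
      PowerSeries.C ((2 : ℤ_[2]) ^ m') * (G * eulerFactorProductInv W 2 S₀) -
        PowerSeries.C ((u : ℤ_[2]) * (2 : ℤ_[2]) ^ m) * (GA * eulerFactorProductInv A 2 S₀)) :
    ∀ (W : WeierstrassCurve ℚ) [W.IsElliptic] [W.IsGloballyMinimal] (A : WeierstrassCurve ℚ) [A.IsElliptic]
      [A.IsGloballyMinimal], ¬ W.HasCM → W.analyticRank = 0 → GoodSS W 2 → W.frobeniusTrace 2 = 0 →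
      A.HasCM → GoodSS A 2 → A.frobeniusTrace 2 = 0 →
    (∃ e : WeierstrassCurve.geomTorsion W (2 : ℤ) ≃+ WeierstrassCurve.geomTorsion A (2 : ℤ),
      ∀ (σ : Field.absoluteGaloisGroup ℚ) (P : WeierstrassCurve.geomTorsion W (2 : ℤ)), e (σ • P) = σ • e P) →
    ∀ (γ : Field.absoluteGaloisGroup ℚ), IsCyclotomicVariable 2 γ →
    ∀ [NeZero (W.conductorNorm ℤ)] (f : CuspForm (Gamma0 (W.conductorNorm ℤ)) 2), IsNewformOf W f →
    ∀ (ϖ : ℚ), (ϖ : ℝ) * W.realPeriodRat = plusPeriod f →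
    ∀ (Lplus Lminus : IwasawaAlgebra 2), IsPollackPair f 2 Lplus Lminus →
    ∀ [NeZero (A.conductorNorm ℤ)] (fA : CuspForm (Gamma0 (A.conductorNorm ℤ)) 2), IsNewformOf A fA →
    ∀ (ϖA : ℚ), (ϖA : ℝ) * A.realPeriodRat = plusPeriod fA →
    ∀ (LplusA LminusA : IwasawaAlgebra 2), IsPollackPair fA 2 LplusA LminusA →
    ∀ (S₀ : Finset (HeightOneSpectrum (𝓞 ℚ))), (∀ v ∈ S₀, ((2 : ℕ) : 𝓞 ℚ) ∉ v.asIdeal) →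
      (∀ v : HeightOneSpectrum (𝓞 ℚ), ¬ W.HasGoodReductionAt v → v ∈ S₀) →
      (∀ v : HeightOneSpectrum (𝓞 ℚ), ¬ A.HasGoodReductionAt v → v ∈ S₀) →
    ∀ (G : IwasawaAlgebra 2) (m : ℕ), iwasawaToPowerSeries 2 G =
        PowerSeries.C ((2 : ℚ_[2]) ^ m * (ϖ : ℚ_[2])) * iwasawaToPowerSeries 2 (kobayashiL 1 Lplus Lminus) →
    ∀ (GA : IwasawaAlgebra 2) (m' : ℕ), iwasawaToPowerSeries 2 GA =
        PowerSeries.C ((2 : ℚ_[2]) ^ m' * (ϖA : ℚ_[2])) * iwasawaToPowerSeries 2 (kobayashiL 1 LplusA LminusA) →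
    mu (GA * eulerFactorProduct A 2 S₀) = m' →
      mu (G * eulerFactorProduct W 2 S₀) = m ∧
        lam (G * eulerFactorProduct W 2 S₀) = lam (GA * eulerFactorProduct A 2 S₀) := by
  intro W _ _ A _ _ hcm hr hss ha hAcm hAss hAa hiso γ hcv _ f hf ϖ hϖ Lplus Lminus hPP _ fA hfA ϖA hϖA
    LplusA LminusA hPPA S₀ hS₀2 hS₀W hS₀A G m hG GA m' hGA hμA
  obtain ⟨u, hu⟩ := hV2congR W A hcm hr hss ha hAcm hAss hAa hiso γ hcv f hf ϖ hϖ Lplus Lminus hPP fA hfA ϖA hϖA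
    LplusA LminusA hPPA S₀ hS₀2 hS₀W hS₀A G m hG GA m' hGA
  have hGA0 : GA ≠ 0 := by
    intro h0
    apply C_pow_mul_ne_zero m' (C_mul_iota_ne_zero hfA hϖA hPPA)
    rw [← hGA, h0, map_zero]
  have hG0W : G ≠ 0 := by
    intro h0
    apply C_pow_mul_ne_zero m (C_mul_iota_ne_zero hf hϖ hPP)
    rw [← hG, h0, map_zero]
  have hFA0 : GA * eulerFactorProductInv A 2 S₀ ≠ 0 := (mu_lam_mul_eulerFactorProductInv_two A S₀ hS₀2 hGA0).1
  obtain ⟨hμAι, hlamAι⟩ := mu_lam_mul_eulerFactorProductInv_eq A S₀ hS₀2 hGA0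
  obtain ⟨hμWι, hlamWι⟩ := mu_lam_mul_eulerFactorProductInv_eq W S₀ hS₀2 hG0W
  have hμA' : mu (GA * eulerFactorProductInv A 2 S₀) = m' := by rw [hμAι]; exact hμA
  have h2 : ((2 : ℕ) : ℤ_[2]) = (2 : ℤ_[2]) := by norm_num
  have hcong : PowerSeries.C (((2 : ℕ) : ℤ_[2]) ^ (m + m' + 1)) ∣
      PowerSeries.C (((2 : ℕ) : ℤ_[2]) ^ m') * (G * eulerFactorProductInv W 2 S₀) -
        PowerSeries.C ((u : ℤ_[2]) * ((2 : ℕ) : ℤ_[2]) ^ m) * (GA * eulerFactorProductInv A 2 S₀) := by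
    rw [h2]; exact hu
  obtain ⟨-, hμ, hlam⟩ := ne_zero_mu_lam_of_congr u hFA0 hμA' hcong
  exact ⟨by rw [← hμWι]; exact hμ, by rw [← hlamWι, hlam, hlamAι]⟩


/-- **R-A layerwise ⇒ `V2congR`**: oriented port of `v2cong_of_v2mt` (p527908) (verbatim, `eulerFactorProduct ↦ eulerFactorProductInv`; `omega_mul_mem_of_layerCongr`
is abstract in the depletion factors, so the proof is unchanged): R-A layerwise ⇒ `V2congR`.
[cite: GreenbergVatsal2000, §1 pp. 8–9, Thm. (1.4), Thm. (1.6)] [cite: Vatsal1999, Thm. (1.10)] -/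
theorem v2congR_of_v2mtR
    (hV2mtR :
    ∀ (W : WeierstrassCurve ℚ) [W.IsElliptic] [W.IsGloballyMinimal] (A : WeierstrassCurve ℚ) [A.IsElliptic]
      [A.IsGloballyMinimal], ¬ W.HasCM → W.analyticRank = 0 → GoodSS W 2 → W.frobeniusTrace 2 = 0 →
      A.HasCM → GoodSS A 2 → A.frobeniusTrace 2 = 0 →
    (∃ e : WeierstrassCurve.geomTorsion W (2 : ℤ) ≃+ WeierstrassCurve.geomTorsion A (2 : ℤ),
      ∀ (σ : Field.absoluteGaloisGroup ℚ) (P : WeierstrassCurve.geomTorsion W (2 : ℤ)), e (σ • P) = σ • e P) →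
    ∀ (γ : Field.absoluteGaloisGroup ℚ), IsCyclotomicVariable 2 γ →
    ∀ [NeZero (W.conductorNorm ℤ)] (f : CuspForm (Gamma0 (W.conductorNorm ℤ)) 2), IsNewformOf W f →
    ∀ (ϖ : ℚ), (ϖ : ℝ) * W.realPeriodRat = plusPeriod f →
    ∀ (Lplus Lminus : IwasawaAlgebra 2), IsPollackPair f 2 Lplus Lminus →
    ∀ [NeZero (A.conductorNorm ℤ)] (fA : CuspForm (Gamma0 (A.conductorNorm ℤ)) 2), IsNewformOf A fA →
    ∀ (ϖA : ℚ), (ϖA : ℝ) * A.realPeriodRat = plusPeriod fA →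
    ∀ (LplusA LminusA : IwasawaAlgebra 2), IsPollackPair fA 2 LplusA LminusA →
    ∀ (S₀ : Finset (HeightOneSpectrum (𝓞 ℚ))), (∀ v ∈ S₀, ((2 : ℕ) : 𝓞 ℚ) ∉ v.asIdeal) →
      (∀ v : HeightOneSpectrum (𝓞 ℚ), ¬ W.HasGoodReductionAt v → v ∈ S₀) →
      (∀ v : HeightOneSpectrum (𝓞 ℚ), ¬ A.HasGoodReductionAt v → v ∈ S₀) →
    ∀ (G : IwasawaAlgebra 2) (m : ℕ), iwasawaToPowerSeries 2 G =
        PowerSeries.C ((2 : ℚ_[2]) ^ m * (ϖ : ℚ_[2])) * iwasawaToPowerSeries 2 (kobayashiL 1 Lplus Lminus) →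
    ∀ (GA : IwasawaAlgebra 2) (m' : ℕ), iwasawaToPowerSeries 2 GA =
        PowerSeries.C ((2 : ℚ_[2]) ^ m' * (ϖA : ℚ_[2])) * iwasawaToPowerSeries 2 (kobayashiL 1 LplusA LminusA) →
    ∃ u : ℤ_[2]ˣ, ∀ n : ℕ, Even n → ∃ q r : IwasawaAlgebra 2,
      PowerSeries.C (((2 : ℤ_[2]) ^ m' : ℤ_[2]) : ℚ_[2]) *
          (PowerSeries.C ((2 : ℚ_[2]) ^ m * (ϖ : ℚ_[2])) *
            ((mazurTateElement f 2 n).map (algebraMap ℚ ℚ_[2]) : PowerSeries ℚ_[2]) *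
            iwasawaToPowerSeries 2 (eulerFactorProductInv W 2 S₀)) -
        PowerSeries.C (((u : ℤ_[2]) * (2 : ℤ_[2]) ^ m : ℤ_[2]) : ℚ_[2]) *
          (PowerSeries.C ((2 : ℚ_[2]) ^ m' * (ϖA : ℚ_[2])) *
            ((mazurTateElement fA 2 n).map (algebraMap ℚ ℚ_[2]) : PowerSeries ℚ_[2]) *
            iwasawaToPowerSeries 2 (eulerFactorProductInv A 2 S₀)) =
      iwasawaToPowerSeries 2
        (PowerSeries.C ((2 : ℤ_[2]) ^ (m + m' + 1)) * q + toIwasawa 2 (cyclotomicOmega 2 n) * r)) :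
    ∀ (W : WeierstrassCurve ℚ) [W.IsElliptic] [W.IsGloballyMinimal] (A : WeierstrassCurve ℚ) [A.IsElliptic]
      [A.IsGloballyMinimal], ¬ W.HasCM → W.analyticRank = 0 → GoodSS W 2 → W.frobeniusTrace 2 = 0 →
      A.HasCM → GoodSS A 2 → A.frobeniusTrace 2 = 0 →
    (∃ e : WeierstrassCurve.geomTorsion W (2 : ℤ) ≃+ WeierstrassCurve.geomTorsion A (2 : ℤ),
      ∀ (σ : Field.absoluteGaloisGroup ℚ) (P : WeierstrassCurve.geomTorsion W (2 : ℤ)), e (σ • P) = σ • e P) →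
    ∀ (γ : Field.absoluteGaloisGroup ℚ), IsCyclotomicVariable 2 γ →
    ∀ [NeZero (W.conductorNorm ℤ)] (f : CuspForm (Gamma0 (W.conductorNorm ℤ)) 2), IsNewformOf W f →
    ∀ (ϖ : ℚ), (ϖ : ℝ) * W.realPeriodRat = plusPeriod f →
    ∀ (Lplus Lminus : IwasawaAlgebra 2), IsPollackPair f 2 Lplus Lminus →
    ∀ [NeZero (A.conductorNorm ℤ)] (fA : CuspForm (Gamma0 (A.conductorNorm ℤ)) 2), IsNewformOf A fA →
    ∀ (ϖA : ℚ), (ϖA : ℝ) * A.realPeriodRat = plusPeriod fA →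
    ∀ (LplusA LminusA : IwasawaAlgebra 2), IsPollackPair fA 2 LplusA LminusA →
    ∀ (S₀ : Finset (HeightOneSpectrum (𝓞 ℚ))), (∀ v ∈ S₀, ((2 : ℕ) : 𝓞 ℚ) ∉ v.asIdeal) →
      (∀ v : HeightOneSpectrum (𝓞 ℚ), ¬ W.HasGoodReductionAt v → v ∈ S₀) →
      (∀ v : HeightOneSpectrum (𝓞 ℚ), ¬ A.HasGoodReductionAt v → v ∈ S₀) →
    ∀ (G : IwasawaAlgebra 2) (m : ℕ), iwasawaToPowerSeries 2 G =
        PowerSeries.C ((2 : ℚ_[2]) ^ m * (ϖ : ℚ_[2])) * iwasawaToPowerSeries 2 (kobayashiL 1 Lplus Lminus) →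
    ∀ (GA : IwasawaAlgebra 2) (m' : ℕ), iwasawaToPowerSeries 2 GA =
        PowerSeries.C ((2 : ℚ_[2]) ^ m' * (ϖA : ℚ_[2])) * iwasawaToPowerSeries 2 (kobayashiL 1 LplusA LminusA) →
    ∃ u : ℤ_[2]ˣ, PowerSeries.C ((2 : ℤ_[2]) ^ (m + m' + 1)) ∣
      PowerSeries.C ((2 : ℤ_[2]) ^ m') * (G * eulerFactorProductInv W 2 S₀) -
        PowerSeries.C ((u : ℤ_[2]) * (2 : ℤ_[2]) ^ m) * (GA * eulerFactorProductInv A 2 S₀) := by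
  intro W _ _ A _ _ hcm hr hss ha hAcm hAss hAa hiso γ hcv _ f hf ϖ hϖ Lplus Lminus hPP _ fA hfA ϖA hϖA
    LplusA LminusA hPPA S₀ hS₀2 hS₀W hS₀A G m hG GA m' hGA
  obtain ⟨u, hu⟩ := hV2mtR W A hcm hr hss ha hAcm hAss hAa hiso γ hcv f hf ϖ hϖ Lplus Lminus hPP fA hfA ϖA hϖA
    LplusA LminusA hPPA S₀ hS₀2 hS₀W hS₀A G m hG GA m' hGA
  refine ⟨u, ?_⟩
  -- Kobayashi's `L^ε` for `ε = 1` is the tree's `L⁻` (= `L♭`), interpolated at the EVEN layers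
  rw [show kobayashiL 1 Lplus Lminus = Lminus from if_pos rfl] at hG
  rw [show kobayashiL 1 LplusA LminusA = LminusA from if_pos rfl] at hGA
  have h2 : ((2 : ℕ) : ℤ_[2]) = (2 : ℤ_[2]) := by norm_num
  -- the limit argument: it suffices that `ω_n^-·X ∈ (2^k, ω_n)Λ` at every even layer
  have key := C_pow_dvd_of_forall_even (p := 2) (m + m' + 1)
    (F := PowerSeries.C ((2 : ℤ_[2]) ^ m') * (G * eulerFactorProductInv W 2 S₀) -
      PowerSeries.C ((u : ℤ_[2]) * (2 : ℤ_[2]) ^ m) * (GA * eulerFactorProductInv A 2 S₀))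
  rw [h2] at key
  refine key fun n hn => ?_
  -- Pollack's interpolation at the even layer `n` on both sides, and the layer-`n` Mazur–Tate congruence
  have hL := hPP.2.2.2 n hn
  have hLA := hPPA.2.2.2 n hn
  obtain ⟨q, r, hqr⟩ := hu n hn
  rw [← h2] at hqr
  obtain ⟨q', r', h'⟩ := omega_mul_mem_of_layerCongr (p := 2) hL hLA hG hGA hqr
  rw [h2] at h'
  -- strip the sign `(−1)^{n/2+1}` (a unit of square `1`)
  have hsign : toIwasawa 2 ((-1) ^ (n / 2 + 1) * cyclotomicOmegaMinus 2 n) =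
      (-1) ^ (n / 2 + 1) * toIwasawa 2 (cyclotomicOmegaMinus 2 n) := by
    rw [map_mul, map_pow, map_neg, map_one]
  rw [hsign] at h'
  have hsq : ((-1 : IwasawaAlgebra 2) ^ (n / 2 + 1)) * ((-1) ^ (n / 2 + 1)) = 1 := by
    rw [← pow_add, ← two_mul, pow_mul, neg_one_sq, one_pow]
  refine ⟨(-1) ^ (n / 2 + 1) * q', (-1) ^ (n / 2 + 1) * r', ?_⟩
  linear_combination ((-1 : IwasawaAlgebra 2) ^ (n / 2 + 1)) * h' -
    (toIwasawa 2 (cyclotomicOmegaMinus 2 n) *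
      (PowerSeries.C ((2 : ℤ_[2]) ^ m') * (G * eulerFactorProductInv W 2 S₀) -
        PowerSeries.C ((u : ℤ_[2]) * (2 : ℤ_[2]) ^ m) * (GA * eulerFactorProductInv A 2 S₀))) * hsq


/-- **ORIENTED COMPOSITION**: Kμ2′ + Kλ2d + R-A (`hV2mtR` = `MazurTateCongruenceAtTwoR` as a ∀-closed binder) ⇒ the crux BY NAME.
[cite: GreenbergVatsal2000, §1 pp. 8–9, Thm. (1.4), Thm. (1.6)] [cite: Vatsal1999, Thm. (1.10)] -/
theorem signedTransportAtTwo_of_gvBinders_mazurTateR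
    (hmuT :
    ∀ (W : WeierstrassCurve ℚ) [W.IsElliptic] [W.IsGloballyMinimal] (A : WeierstrassCurve ℚ) [A.IsElliptic]
      [A.IsGloballyMinimal], ¬ W.HasCM → W.analyticRank = 0 → GoodSS W 2 → W.frobeniusTrace 2 = 0 →
      A.HasCM → GoodSS A 2 → A.frobeniusTrace 2 = 0 →
    (∃ e : WeierstrassCurve.geomTorsion W (2 : ℤ) ≃+ WeierstrassCurve.geomTorsion A (2 : ℤ),
      ∀ (σ : Field.absoluteGaloisGroup ℚ) (P : WeierstrassCurve.geomTorsion W (2 : ℤ)), e (σ • P) = σ • e P) →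
    ∀ (κ : ZpExtension ℚ 2) (γ : Field.absoluteGaloisGroup ℚ), κ.IsCyclotomic → κ.IsTopGenerator γ →
    ∀ (D : SignedSelmerDualData W κ γ 1) (D' : SignedSelmerDualData A κ γ 1)
      [Module.Finite (IwasawaAlgebra 2) D.X] [Module.Finite (IwasawaAlgebra 2) D'.X],
      Module.IsTorsion (IwasawaAlgebra 2) D'.X → D'.mu = 0 →
      Module.IsTorsion (IwasawaAlgebra 2) D.X ∧ D.mu = 0)
    (hlam2 :
    ∀ (W : WeierstrassCurve ℚ) [W.IsElliptic] [W.IsGloballyMinimal] (A : WeierstrassCurve ℚ) [A.IsElliptic]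
      [A.IsGloballyMinimal], ¬ W.HasCM → W.analyticRank = 0 → GoodSS W 2 → W.frobeniusTrace 2 = 0 →
      A.HasCM → GoodSS A 2 → A.frobeniusTrace 2 = 0 →
    (∃ e : WeierstrassCurve.geomTorsion W (2 : ℤ) ≃+ WeierstrassCurve.geomTorsion A (2 : ℤ),
      ∀ (σ : Field.absoluteGaloisGroup ℚ) (P : WeierstrassCurve.geomTorsion W (2 : ℤ)), e (σ • P) = σ • e P) →
    ∀ (κ : ZpExtension ℚ 2) (γ : Field.absoluteGaloisGroup ℚ), κ.IsCyclotomic → κ.IsTopGenerator γ →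
    ∀ (S₀ : Finset (HeightOneSpectrum (𝓞 ℚ))), (∀ v ∈ S₀, ((2 : ℕ) : 𝓞 ℚ) ∉ v.asIdeal) →
      (∀ v : HeightOneSpectrum (𝓞 ℚ), ¬ W.HasGoodReductionAt v → v ∈ S₀) →
      (∀ v : HeightOneSpectrum (𝓞 ℚ), ¬ A.HasGoodReductionAt v → v ∈ S₀) →
    ∀ (D : SignedSelmerDualData W κ γ 1) (D' : SignedSelmerDualData A κ γ 1)
      [Module.Finite (IwasawaAlgebra 2) D.X] [Module.Finite (IwasawaAlgebra 2) D'.X],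
      Module.IsTorsion (IwasawaAlgebra 2) D.X → Module.IsTorsion (IwasawaAlgebra 2) D'.X → D.mu = 0 → D'.mu = 0 →
      lambdaInvariant 2 D.X +
          ∑ v ∈ S₀, 2 ^ padicValNat 2 ((Rat.HeightOneSpectrum.natGenerator v ^ 2 - 1) / 8) * dMultiplicity W 2 v =
        lambdaInvariant 2 D'.X +
          ∑ v ∈ S₀, 2 ^ padicValNat 2 ((Rat.HeightOneSpectrum.natGenerator v ^ 2 - 1) / 8) * dMultiplicity A 2 v)
    (hV2mtR :
    ∀ (W : WeierstrassCurve ℚ) [W.IsElliptic] [W.IsGloballyMinimal] (A : WeierstrassCurve ℚ) [A.IsElliptic]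
      [A.IsGloballyMinimal], ¬ W.HasCM → W.analyticRank = 0 → GoodSS W 2 → W.frobeniusTrace 2 = 0 →
      A.HasCM → GoodSS A 2 → A.frobeniusTrace 2 = 0 →
    (∃ e : WeierstrassCurve.geomTorsion W (2 : ℤ) ≃+ WeierstrassCurve.geomTorsion A (2 : ℤ),
      ∀ (σ : Field.absoluteGaloisGroup ℚ) (P : WeierstrassCurve.geomTorsion W (2 : ℤ)), e (σ • P) = σ • e P) →
    ∀ (γ : Field.absoluteGaloisGroup ℚ), IsCyclotomicVariable 2 γ →
    ∀ [NeZero (W.conductorNorm ℤ)] (f : CuspForm (Gamma0 (W.conductorNorm ℤ)) 2), IsNewformOf W f →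
    ∀ (ϖ : ℚ), (ϖ : ℝ) * W.realPeriodRat = plusPeriod f →
    ∀ (Lplus Lminus : IwasawaAlgebra 2), IsPollackPair f 2 Lplus Lminus →
    ∀ [NeZero (A.conductorNorm ℤ)] (fA : CuspForm (Gamma0 (A.conductorNorm ℤ)) 2), IsNewformOf A fA →
    ∀ (ϖA : ℚ), (ϖA : ℝ) * A.realPeriodRat = plusPeriod fA →
    ∀ (LplusA LminusA : IwasawaAlgebra 2), IsPollackPair fA 2 LplusA LminusA →
    ∀ (S₀ : Finset (HeightOneSpectrum (𝓞 ℚ))), (∀ v ∈ S₀, ((2 : ℕ) : 𝓞 ℚ) ∉ v.asIdeal) →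
      (∀ v : HeightOneSpectrum (𝓞 ℚ), ¬ W.HasGoodReductionAt v → v ∈ S₀) →
      (∀ v : HeightOneSpectrum (𝓞 ℚ), ¬ A.HasGoodReductionAt v → v ∈ S₀) →
    ∀ (G : IwasawaAlgebra 2) (m : ℕ), iwasawaToPowerSeries 2 G =
        PowerSeries.C ((2 : ℚ_[2]) ^ m * (ϖ : ℚ_[2])) * iwasawaToPowerSeries 2 (kobayashiL 1 Lplus Lminus) →
    ∀ (GA : IwasawaAlgebra 2) (m' : ℕ), iwasawaToPowerSeries 2 GA =
        PowerSeries.C ((2 : ℚ_[2]) ^ m' * (ϖA : ℚ_[2])) * iwasawaToPowerSeries 2 (kobayashiL 1 LplusA LminusA) →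
    ∃ u : ℤ_[2]ˣ, ∀ n : ℕ, Even n → ∃ q r : IwasawaAlgebra 2,
      PowerSeries.C (((2 : ℤ_[2]) ^ m' : ℤ_[2]) : ℚ_[2]) *
          (PowerSeries.C ((2 : ℚ_[2]) ^ m * (ϖ : ℚ_[2])) *
            ((mazurTateElement f 2 n).map (algebraMap ℚ ℚ_[2]) : PowerSeries ℚ_[2]) *
            iwasawaToPowerSeries 2 (eulerFactorProductInv W 2 S₀)) -
        PowerSeries.C (((u : ℤ_[2]) * (2 : ℤ_[2]) ^ m : ℤ_[2]) : ℚ_[2]) *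
          (PowerSeries.C ((2 : ℚ_[2]) ^ m' * (ϖA : ℚ_[2])) *
            ((mazurTateElement fA 2 n).map (algebraMap ℚ ℚ_[2]) : PowerSeries ℚ_[2]) *
            iwasawaToPowerSeries 2 (eulerFactorProductInv A 2 S₀)) =
      iwasawaToPowerSeries 2
        (PowerSeries.C ((2 : ℤ_[2]) ^ (m + m' + 1)) * q + toIwasawa 2 (cyclotomicOmega 2 n) * r)) :
    Summit.BirchSwinnertonDyer.BirchSwinnertonDyer.Theses.ThetaPartnerAtTwo.SignedTransportAtTwo :=
  signedTransportAtTwo_of_gvBinders_nonPrimitive hmuT hlam2 (v2np_of_v2congR (v2congR_of_v2mtR hV2mtR))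

end Summit.BirchSwinnertonDyer.BirchSwinnertonDyer.Theorems.SignedTransportAtTwo

end
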